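import Summits.ValiantsHypothesis.ValiantsHypothesis.Theses.DivisionGap
import Summits.ValiantsHypothesis.ValiantsHypothesis.Theorems.DivisionGapZeroOneTransferDivSubstClosure
import Summits.ValiantsHypothesis.ValiantsHypothesis.Theorems.DivisionGapZeroOneTransferSparsePolyComplexity
import Literature.Computability.AlgebraicComplexity.ArithCircuitProofs

/-!
# Crux `DivisionGap.ZeroOneTransfer` (stmt-ValiantsHypothesis-5066), line `charged-uncharged` —
registered stub `stub_uniformOfZot`: THE CRUX IMPLIES ITS UNIFORM FORM (finiteness + diagonal)

**Claim settled** (stub C2 of the lead's skeleton, TRUE): `ZeroOneTransfer` implies its UNIFORM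
form — for every exponent `e` ONE constant `c` such that every 0/1 polynomial `f` over `ℝ≥0` in a
finite variable type of size `≤ n^e + e`, of total degree `≤ n^e + e` and of `ℂ`-complexity
`≤ n^e + e`, has a nonzero `h` with `L₊(f·h) + L₊(h) ≤ 2^((log₂ n + c)^c)`.

Proof (write `V n = n^e + e`; "admissible at level `n`" = 0/1 coefficients, total degree `≤ V n`,
`ℂ`-complexity `≤ V n`; "good at `(n, c)`" = has a nonzero `h` with
`L₊(g h) + L₊(h) ≤ 2^((log₂ n + c)^c)`).

* REDUCTION TO `Fin (V n)` (`coeff_rename_zero_or_one`, `complexity_map_rename_le`,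
  `good_of_good_rename`): rename a polynomial in `τ`, `#τ ≤ V n`, injectively into `Fin (V n)`;
  admissibility persists (`coeff_rename_mapDomain` / `coeff_rename_eq_zero`,
  `totalDegree_rename_le`, `map_rename` + `complexity_rename_le`), and goodness of the renamed
  polynomial pulls back: a certificate `h'` for `rename ι f` transports along the retraction
  `Fin (V n) → {X t} ∪ {1}` at NO cost (`stub_divSubstClosure`, every substituend is free).
* FINITENESS (`card_support_le_pow`, `complexity_le_of_totalDegree_le`, `le_of_not_good`): a
  polynomial in `Fin N` of total degree `≤ N` has `≤ (N+1)^N` monomials, hence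
  (`stub_sparsePolyComplexity`) the certificate `h = 1` of explicit cost `D N`; so it is good at
  every `c > D N` (`c ≤ 2^((a + c)^c)`): the constants violated at a level are bounded.
* DIAGONAL (`exists_worst`, abstract): at each level pick an admissible polynomial violating the
  LARGEST violated constant (or `0`); by monotonicity of `2^((a + c)^c)` in `c` it violates every
  constant violated by anyone at that level.  These choices form ONE 0/1 `VP_ℂ` family in
  `Fin (V n)` variables; the crux gives it a constant `c₀`, which therefore is violated by no
  admissible polynomial at any level — `c₀` is the uniform constant.

Unconditional (axioms `propext`, `Classical.choice`, `Quot.sound`).  Helper namespace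
`UniformOfZot`. References: [Burgisser2000] Defs. 2.1–2.4 (the classes); the statement is folklore
bookkeeping (compactness of the constant).
-/

set_option linter.dupNamespace false

namespace Summit.ValiantsHypothesis.ValiantsHypothesis.Theorems.DivisionGapZeroOneTransfer

open MvPolynomial Literature.Computability.AlgebraicComplexity
open Summit.ValiantsHypothesis.ValiantsHypothesis.Theses.DivisionGap
open scoped NNReal

namespace UniformOfZot

/-! ### Arithmetic of the threshold `2 ^ ((a + c) ^ c)` -/

/-- The quasi-polynomial threshold `2 ^ ((a + c) ^ c)` is monotone in the constant `c` (beware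
`0 ^ 0 = 1`: for `c = 0` the exponent is `1 ≤ (a + c') ^ c'`). [folklore] -/
theorem threshold_mono (a : ℕ) {c c' : ℕ} (h : c ≤ c') :
    2 ^ ((a + c) ^ c) ≤ 2 ^ ((a + c') ^ c') := by
  apply Nat.pow_le_pow_right (by norm_num)
  rcases Nat.eq_zero_or_pos c with rfl | hc
  · rw [pow_zero]
    exact Nat.pos_of_ne_zero fun h0 => by rw [Nat.pow_eq_zero] at h0; omega
  · exact (Nat.pow_le_pow_left (by omega) c).trans (Nat.pow_le_pow_right (by omega) h)

/-- The constant lies below its own threshold: `c ≤ 2 ^ ((a + c) ^ c)`. [folklore] -/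
theorem le_threshold (a c : ℕ) : c ≤ 2 ^ ((a + c) ^ c) := by
  rcases Nat.eq_zero_or_pos c with rfl | hc
  · exact Nat.zero_le _
  · calc c ≤ 2 ^ c := c.lt_two_pow_self.le
      _ ≤ 2 ^ ((a + c) ^ c) := Nat.pow_le_pow_right (by norm_num)
          ((Nat.le_add_left c a).trans (Nat.le_self_pow hc.ne' _))

/-! ### The diagonal choice (abstract) -/

/-- **Worst element at a level** (abstract diagonal step).  `A` = admissible, `G c x` = "`x` is
good at constant `c`", monotone in `c`; every admissible `x` is good beyond a fixed `D`; `A` is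
inhabited.  Then some admissible `x` is bad at EVERY constant at which some admissible element is
bad: take a witness of the largest bad constant (`Nat.sSup_mem`; the bad constants are bounded by
`D`), or any admissible element if nothing is bad. [folklore] -/
theorem exists_worst {α : Type*} (A : α → Prop) (G : ℕ → α → Prop) (D : ℕ)
    (hmono : ∀ x c c', c ≤ c' → G c x → G c' x)
    (hD : ∀ x, A x → ∀ c, ¬ G c x → c ≤ D) {a₀ : α} (ha₀ : A a₀) :
    ∃ x, A x ∧ ∀ c, (∃ y, A y ∧ ¬ G c y) → ¬ G c x := by
  by_cases hne : ∃ c y, A y ∧ ¬ G c y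
  · have hbdd : BddAbove {c | ∃ y, A y ∧ ¬ G c y} :=
      ⟨D, fun c ⟨y, hy, hyc⟩ => hD y hy c hyc⟩
    have hSne : Set.Nonempty {c | ∃ y, A y ∧ ¬ G c y} := hne
    obtain ⟨x, hx, hxS⟩ := Nat.sSup_mem hSne hbdd
    exact ⟨x, hx, fun c hc hG => hxS (hmono x c _ (le_csSup hbdd hc) hG)⟩
  · push Not at hne
    exact ⟨a₀, ha₀, fun c ⟨y, hy, hyc⟩ => absurd (hne c y hy) hyc⟩

/-! ### Finiteness at a level: every low-degree polynomial in `Fin N` has the certificate `h = 1` -/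

/-- A polynomial in `N` variables of total degree `≤ N` has at most `(N + 1) ^ N` monomials: every
exponent vector of its support has all entries `≤ N`, so truncation at `N` injects the support into
`Fin N → Fin (N + 1)`. [folklore] -/
theorem card_support_le_pow {N : ℕ} (g : MvPolynomial (Fin N) ℝ≥0) (hdeg : g.totalDegree ≤ N) :
    g.support.card ≤ (N + 1) ^ N := by
  classical
  have hb : ∀ m ∈ g.support, ∀ j, m j ≤ N := fun m hm j =>
    ((monomial_le_degreeOf j hm).trans (degreeOf_le_totalDegree g j)).trans hdeg
  let T : (Fin N →₀ ℕ) → (Fin N → Fin (N + 1)) := fun m j => ⟨min (m j) N, by omega⟩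
  calc g.support.card ≤ (Finset.univ : Finset (Fin N → Fin (N + 1))).card :=
        Finset.card_le_card_of_injOn T (fun _ _ => Finset.mem_coe.2 (Finset.mem_univ _)) ?_
    _ = (N + 1) ^ N := by
        rw [Finset.card_univ, Fintype.card_fun, Fintype.card_fin, Fintype.card_fin]
  intro m hm m' hm' hT
  ext j
  have h1 := hb m hm j
  have h2 := hb m' hm' j
  have h3 : min (m j) N = min (m' j) N := by
    have h := congrFun hT j
    simp only [T, Fin.mk.injEq] at h
    exact h
  omega

/-- Every polynomial over `ℝ≥0` in `N` variables of total degree `≤ N` is cheap: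
`L(g) ≤ 2 T T + 2 T` with `T = (N + 1) ^ N + N` (`stub_sparsePolyComplexity`). [folklore] -/
theorem complexity_le_of_totalDegree_le {N : ℕ} (g : MvPolynomial (Fin N) ℝ≥0)
    (hdeg : g.totalDegree ≤ N) :
    complexity g ≤ 2 * ((N + 1) ^ N + N) * ((N + 1) ^ N + N) + 2 * ((N + 1) ^ N + N) :=
  stub_sparsePolyComplexity (Fin N) _ g ((card_support_le_pow g hdeg).trans (Nat.le_add_right _ _))
    (hdeg.trans (Nat.le_add_left _ _))

/-- **Bounded violation at a level.**  If a polynomial over `ℝ≥0` in `N` variables of total degree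
`≤ N` has NO nonzero `h` with `L(g h) + L(h) ≤ 2 ^ ((a + c) ^ c)`, then `c ≤ 2 T T + 2 T`,
`T = (N + 1) ^ N + N`: otherwise `h = 1` is such a certificate (`L(1) = 0`, `c ≤ 2 ^ ((a + c) ^ c)`).
[folklore] -/
theorem le_of_not_good {N : ℕ} (g : MvPolynomial (Fin N) ℝ≥0) (hdeg : g.totalDegree ≤ N)
    {a c : ℕ} (hng : ¬ ∃ h : MvPolynomial (Fin N) ℝ≥0, h ≠ 0 ∧
      complexity (g * h) + complexity h ≤ 2 ^ ((a + c) ^ c)) :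
    c ≤ 2 * ((N + 1) ^ N + N) * ((N + 1) ^ N + N) + 2 * ((N + 1) ^ N + N) := by
  by_contra hlt
  refine hng ⟨1, one_ne_zero, ?_⟩
  rw [mul_one, DivSubstClosure.complexity_one, add_zero]
  exact ((complexity_le_of_totalDegree_le g hdeg).trans (not_le.mp hlt).le).trans
    (le_threshold a c)

/-! ### Reduction of a finite variable type to `Fin N` -/

/-- A finite type of size `≤ N` injects into `Fin N`. [folklore] -/
theorem exists_injective_fin {τ : Type} [Fintype τ] {N : ℕ} (h : Fintype.card τ ≤ N) :
    ∃ ι : τ → Fin N, Function.Injective ι :=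
  ⟨fun t => Fin.castLE h (Fintype.equivFin τ t),
    (Fin.castLE_injective h).comp (Fintype.equivFin τ).injective⟩

/-- An injective renaming has a FREE retraction: a substitution `ρ` with `ρ (ι t) = X t` and every
`ρ j` of complexity `0` (a variable or the constant `1`). [folklore] -/
theorem exists_retraction {τ κ : Type} (ι : τ → κ) (hι : Function.Injective ι) :
    ∃ ρ : κ → MvPolynomial τ ℝ≥0, (∀ t, ρ (ι t) = X t) ∧ ∀ j, complexity (ρ j) = 0 := by
  classical
  refine ⟨fun j => if h : ∃ t, ι t = j then X h.choose else 1, fun t => ?_, fun j => ?_⟩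
  · have h : ∃ t', ι t' = ι t := ⟨t, rfl⟩
    dsimp only
    rw [dif_pos h, hι h.choose_spec]
  · dsimp only
    split_ifs with h
    · exact complexity_X_holds _
    · exact DivSubstClosure.complexity_one

/-- **Certificates pull back along injective renamings at no cost.**  If `rename ι f` has a
nonzero `h` with `L(rename ι f · h) + L(h) ≤ B` then so does `f`: transport along the free
retraction of `ι` (`stub_divSubstClosure` with `Σ_j L(ρ j) = 0`, and
`aeval ρ (rename ι f) = aeval (ρ ∘ ι) f = aeval X f = f`). [folklore] -/
theorem good_of_good_rename {τ κ : Type} [Fintype κ] {ι : τ → κ} (hι : Function.Injective ι)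
    (f : MvPolynomial τ ℝ≥0) {B : ℕ}
    (hg : ∃ h : MvPolynomial κ ℝ≥0, h ≠ 0 ∧ complexity (rename ι f * h) + complexity h ≤ B) :
    ∃ h : MvPolynomial τ ℝ≥0, h ≠ 0 ∧ complexity (f * h) + complexity h ≤ B := by
  obtain ⟨ρ, hρX, hρ0⟩ := exists_retraction ι hι
  obtain ⟨h', hh', hle⟩ := hg
  obtain ⟨h, hh, h1, h2⟩ := stub_divSubstClosure κ τ (rename ι f) ρ h' hh'
  have hsum : ∑ j, complexity (ρ j) = 0 := Finset.sum_eq_zero fun j _ => hρ0 j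
  have hf : aeval ρ (rename ι f) = f := by
    rw [aeval_rename, show ρ ∘ ι = X from funext hρX, aeval_X_left_apply]
  rw [hsum, add_zero] at h1 h2
  rw [hf] at h1
  exact ⟨h, hh, (Nat.add_le_add h1 h2).trans hle⟩

/-- 0/1 coefficients persist under injective renaming: a coefficient of `rename ι f` is either a
coefficient of `f` (exponent in the image of `mapDomain ι`) or `0`. [folklore] -/
theorem coeff_rename_zero_or_one {τ κ : Type} {ι : τ → κ} (hι : Function.Injective ι)
    {f : MvPolynomial τ ℝ≥0} (h01 : ∀ m, coeff m f = 0 ∨ coeff m f = 1) (d : κ →₀ ℕ) :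
    coeff d (rename ι f) = 0 ∨ coeff d (rename ι f) = 1 := by
  by_cases hd : ∃ u : τ →₀ ℕ, Finsupp.mapDomain ι u = d
  · obtain ⟨u, rfl⟩ := hd
    rw [coeff_rename_mapDomain ι hι]
    exact h01 u
  · exact Or.inl (coeff_rename_eq_zero ι f d fun u hu => absurd ⟨u, hu⟩ hd)

/-- The complexity over a coefficient extension does not grow under renaming
(`map ψ (rename ι f) = rename ι (map ψ f)` and `complexity_rename_le`). [folklore] -/
theorem complexity_map_rename_le {τ κ : Type} {S : Type} [CommSemiring S] (ψ : ℝ≥0 →+* S)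
    (ι : τ → κ) (f : MvPolynomial τ ℝ≥0) :
    complexity (map ψ (rename ι f)) ≤ complexity (map ψ f) := by
  rw [map_rename]
  exact complexity_rename_le_holds' ι _

end UniformOfZot

/-- **Stub C2 — the crux implies its uniform form** (finiteness + diagonal).  Fix `e`; call a
polynomial over `ℝ≥0` in `Fin (n^e+e)` ADMISSIBLE at level `n` if it has 0/1 coefficients, total
degree `≤ n^e + e` and `ℂ`-complexity `≤ n^e + e`, and GOOD at `(n, c)` if some nonzero `h` has
`L₊(g h) + L₊(h) ≤ 2^((log₂ n + c)^c)`.  (i) FINITENESS: every admissible `g` is good at every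
`c` beyond an explicit `D n` (certificate `h = 1`: `g` has `≤ (n^e+e+1)^(n^e+e)` monomials, so
`stub_sparsePolyComplexity` bounds `L₊(g)`, and `c ≤ 2^((log₂ n + c)^c)`), so the constants violated
at level `n` are bounded.  (ii) DIAGONAL: let `F n` be an admissible violator of the LARGEST
violated constant at level `n` (`Nat.sSup_mem`; `0` if nothing is violated); by monotonicity of
`2^((log₂ n + c)^c)` in `c`, `F n` violates every constant violated at level `n`.  `n ↦ F n` is a
0/1 family in `Fin (n^e+e)` variables of degree and `ℂ`-complexity `≤ n^e + e`, hence `IsVPFamily`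
over `ℂ` (`#Fin (n^e+e) = n^e+e`, `deg (map φ g) ≤ deg g`); the crux gives it ONE constant `c₀`,
so NO admissible polynomial violates `c₀` at any level.  (iii) REDUCTION TO `Fin (n^e+e)`: a
general `f` in `τ`, `#τ ≤ n^e + e`, renames injectively into `Fin (n^e + e)`; 0/1 coefficients
(`coeff_rename_mapDomain` / `coeff_rename_eq_zero`), the degree bound (`totalDegree_rename_le`) and
the `ℂ`-complexity bound (`complexity_rename_le` after `map_rename`) persist, and a certificate for
`rename ι f` pulls back to `f` along the free retraction `Fin (n^e+e) → {X t} ∪ {1}`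
(`stub_divSubstClosure`, all substituends of complexity `0`); so `f` is good at `c₀`. [folklore] -/
theorem stub_uniformOfZot :
    ZeroOneTransfer →
    ∀ e : ℕ, ∃ c : ℕ, ∀ (n : ℕ) (τ : Type) [Fintype τ] (f : MvPolynomial τ NNReal),
      (∀ m, MvPolynomial.coeff m f = 0 ∨ MvPolynomial.coeff m f = 1) →
      Fintype.card τ ≤ n ^ e + e → f.totalDegree ≤ n ^ e + e →
      Literature.Computability.AlgebraicComplexity.complexity
        (MvPolynomial.map (Complex.ofRealHom.comp NNReal.toRealHom) f) ≤ n ^ e + e →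
      ∃ h : MvPolynomial τ NNReal, h ≠ 0 ∧
        Literature.Computability.AlgebraicComplexity.complexity (f * h) +
          Literature.Computability.AlgebraicComplexity.complexity h ≤ 2 ^ ((Nat.log 2 n + c) ^ c) := by
  intro hZ e
  -- DIAGONAL: at every level `n` a worst admissible polynomial in `Fin (n ^ e + e)` variables
  have key : ∀ n : ℕ, ∃ g : MvPolynomial (Fin (n ^ e + e)) ℝ≥0,
      ((∀ m, coeff m g = 0 ∨ coeff m g = 1) ∧ g.totalDegree ≤ n ^ e + e ∧
        complexity (map (Complex.ofRealHom.comp NNReal.toRealHom) g) ≤ n ^ e + e) ∧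
      ∀ c : ℕ, (∃ g' : MvPolynomial (Fin (n ^ e + e)) ℝ≥0,
          ((∀ m, coeff m g' = 0 ∨ coeff m g' = 1) ∧ g'.totalDegree ≤ n ^ e + e ∧
            complexity (map (Complex.ofRealHom.comp NNReal.toRealHom) g') ≤ n ^ e + e) ∧
          ¬ ∃ h : MvPolynomial (Fin (n ^ e + e)) ℝ≥0, h ≠ 0 ∧
            complexity (g' * h) + complexity h ≤ 2 ^ ((Nat.log 2 n + c) ^ c)) →
        ¬ ∃ h : MvPolynomial (Fin (n ^ e + e)) ℝ≥0, h ≠ 0 ∧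
          complexity (g * h) + complexity h ≤ 2 ^ ((Nat.log 2 n + c) ^ c) := by
    intro n
    refine UniformOfZot.exists_worst _ _ _ (fun g c c' hcc' ⟨h, hh, hle⟩ =>
      ⟨h, hh, hle.trans (UniformOfZot.threshold_mono _ hcc')⟩)
      (fun g hg c hng => UniformOfZot.le_of_not_good g hg.2.1 hng) (a₀ := 0) ⟨?_, ?_, ?_⟩
    · exact fun m => Or.inl (coeff_zero m)
    · rw [totalDegree_zero]; exact Nat.zero_le _
    · rw [map_zero, ← C_0, complexity_C_holds]; exact Nat.zero_le _
  choose F hF using key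
  -- the diagonal family is a 0/1 `VP_ℂ` family; the crux gives it ONE constant `c₀`
  obtain ⟨c₀, hc₀⟩ := hZ (fun n => Fin (n ^ e + e)) F (fun n => (hF n).1.1)
    ⟨⟨⟨e, fun n => (Fintype.card_fin _).le⟩,
      ⟨e, fun n => le_trans (Finset.sup_mono (support_map_subset _ _)) (hF n).1.2.1⟩⟩,
      ⟨e, fun n => (hF n).1.2.2⟩⟩
  -- `c₀` is the uniform constant: a violator renames into `Fin (n ^ e + e)` and stays a violator
  refine ⟨c₀, fun n τ _ f h01 hcard hdeg hcx => ?_⟩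
  by_contra hbad
  obtain ⟨ι, hι⟩ := UniformOfZot.exists_injective_fin hcard
  exact (hF n).2 c₀ ⟨rename ι f, ⟨UniformOfZot.coeff_rename_zero_or_one hι h01,
      (totalDegree_rename_le ι f).trans hdeg,
      (UniformOfZot.complexity_map_rename_le _ ι f).trans hcx⟩,
    fun hg => hbad (UniformOfZot.good_of_good_rename hι f hg)⟩ (hc₀ n)

end Summit.ValiantsHypothesis.ValiantsHypothesis.Theorems.DivisionGapZeroOneTransfer
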